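import Summits.MatrixMultiplication.OmegaCensus.PeriodicBoxWindow
import Summits.MatrixMultiplication.OmegaCensus.DicyclicLawReduction
import Summits.MatrixMultiplication.OmegaCensus.DicyclicExactTiling
import Summits.MatrixMultiplication.OmegaCensus.DihedralLikeVertexCounting
import HarnessLib

/-!
# Class N3 (`(2,2),(2,2),(u,u+1)`) of the dicyclic-law triples: a member is stable, hence no such triple when `A/⟨c₀⟩` is a
# `2`-group mapping onto `𝔽₂³`

ω-census `pub-omega`, family (b3), seat pub-omega-group gen 11.  Framing: lottery ticket; floor = certified bounds/negative
ranges.  VALUE: kernel theorems about the group-theoretic method (TPP capacity of dihedral-like groups); NOT progress on ω.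

Dicyclic type `G(A, c₀)` (`c₀ ≠ 0`), `π : A →+ B` onto with kernel `{0, c₀}`, `B` a `2`-group.  A TPP triple `(S, T, U)` with coset
parts `|S₀| = |S₁| = |T₀| = |T₁| = 2`, `|U₁| = |U₀| + 1` odd and `|A| = 12|U₀| + 8` (the N3 class of the dicyclic law
`3|S||T||U| + 16 = 8|A|`) has the vertex `111` exact, so the box `S₁ + T₀ + U₁` is `c₀`-periodic (`periodic_of_exact_vertex`);
by `pair_diff_trichotomy_of_periodic_box` (`PeriodicBoxWindow.lean`, the `𝔽₂[B]` window lemma) the differences `d₁` of `S₁` and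
`e₀` of `T₀` satisfy `π d₁ = 0 ∨ π e₀ = 0 ∨ (π d₁ = π e₀ ∧ 2π d₁ = 0)` (`n3_pair_trichotomy_core`).  Applying this to the four
translates `(S·τ0^a, T·τ0^b, U)` gives the trichotomy for all four pairs `(dᵢ, eⱼ)`, and `stable_pair_of_trichotomy` makes `S` or
`T` stable under a central involution (`n3_stable_member`).  With `no_dicyclic_law_of_stable_member` (`DicyclicLawReduction.lean`):
**no N3-class triple attains the dicyclic law when `A/⟨c₀⟩` is a `2`-group mapping onto `𝔽₂³`** (`no_n3_dicyclic_law`) — e.g. in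
`C₂² × Q_{4^{j+1}}`.  (The two-domino class is `no_two_domino_dicyclic_law_of_rank_three`; classes B/N1/N2 remain.)
-/

namespace Summit.MatrixMultiplication.OmegaCensus

open Literature.Combinatorics.Additive Finset

section N3

variable {A : Type} [AddCommGroup A] [DecidableEq A] [Fintype A] {G : Type} [Group G] [DecidableEq G]
  {ρ τ : A → G} {c₀ : A} {B : Type} [AddCommGroup B] [DecidableEq B] [Fintype B]

/-- **Core (vertex `111`).**  Dicyclic type, `π : A →+ B` with kernel `{0, c₀}`, `2^m · B = 0`; a TPP triple with
`|S₀| = |S₁| = |T₀| = 2`, `|U₁|` odd and the vertex `111` exact (`8|T₁||U₁|·… `: `2|T₁||U₁| + 4|U₁| + 2|T₁||U₀| = |A|`).  Then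
for `S₁ = {s, s'}`, `T₀ = {t, t'}`: `π(s'−s) = 0 ∨ π(t'−t) = 0 ∨ (π(s'−s) = π(t'−t) ∧ 2π(s'−s) = 0)`. [folklore] -/
theorem n3_pair_trichotomy_core
    (hρρ : ∀ a b, ρ a * ρ b = ρ (a + b)) (hρτ : ∀ a b, ρ a * τ b = τ (b - a))
    (hτρ : ∀ a b, τ a * ρ b = τ (a + b)) (hττ : ∀ a b, τ a * τ b = ρ (c₀ + b - a)) (hc₀ : c₀ ≠ 0)
    (hρ : Function.Injective ρ) (hτ : Function.Injective τ) (hne : ∀ a b, ρ a ≠ τ b)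
    (π : A →+ B) (hker : ∀ a : A, π a = 0 ↔ a = 0 ∨ a = c₀) {m : ℕ} (hB : ∀ b : B, (2 ^ m) • b = 0)
    {S T U : Finset G} (h : TripleProductProperty S T U)
    (hs₀ : (univ.filter fun a : A => ρ a ∈ S).card = 2) (hs₁ : (univ.filter fun a : A => τ a ∈ S).card = 2)
    (ht₀ : (univ.filter fun a : A => ρ a ∈ T).card = 2)
    (hodd : Odd (univ.filter fun a : A => τ a ∈ U).card)
    (hex : 2 * (univ.filter fun a : A => τ a ∈ T).card * (univ.filter fun a : A => τ a ∈ U).card +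
      4 * (univ.filter fun a : A => τ a ∈ U).card +
      2 * (univ.filter fun a : A => τ a ∈ T).card * (univ.filter fun a : A => ρ a ∈ U).card = Fintype.card A)
    {s s' t t' : A} (hs : s ∈ (univ.filter fun a : A => τ a ∈ S)) (hs' : s' ∈ (univ.filter fun a : A => τ a ∈ S))
    (hss : s ≠ s') (ht : t ∈ (univ.filter fun a : A => ρ a ∈ T)) (ht' : t' ∈ (univ.filter fun a : A => ρ a ∈ T))
    (htt : t ≠ t') :
    π (s' - s) = 0 ∨ π (t' - t) = 0 ∨ (π (s' - s) = π (t' - t) ∧ π (s' - s) + π (s' - s) = 0) := by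
  set S₀ : Finset A := univ.filter fun a => ρ a ∈ S with hS₀
  set S₁ : Finset A := univ.filter fun a => τ a ∈ S with hS₁
  set T₀ : Finset A := univ.filter fun a => ρ a ∈ T with hT₀
  set T₁ : Finset A := univ.filter fun a => τ a ∈ T with hT₁
  set U₀ : Finset A := univ.filter fun a => ρ a ∈ U with hU₀
  set U₁ : Finset A := univ.filter fun a => τ a ∈ U with hU₁
  have h2c := two_c0_eq_zero hρτ hτρ hττ hτ
  have mS₀ : ∀ a ∈ S₀, cond false (τ a) (ρ a) ∈ S := fun a ha => by simpa [hS₀] using ha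
  have mS₁ : ∀ a ∈ S₁, cond true (τ a) (ρ a) ∈ S := fun a ha => by simpa [hS₁] using ha
  have mT₀ : ∀ a ∈ T₀, cond false (τ a) (ρ a) ∈ T := fun a ha => by simpa [hT₀] using ha
  have mT₁ : ∀ a ∈ T₁, cond true (τ a) (ρ a) ∈ T := fun a ha => by simpa [hT₁] using ha
  have mU₀ : ∀ a ∈ U₀, cond false (τ a) (ρ a) ∈ U := fun a ha => by simpa [hU₀] using ha
  have mU₁ : ∀ a ∈ U₁, cond true (τ a) (ρ a) ∈ U := fun a ha => by simpa [hU₁] using ha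
  have cs := card_sumset' hρρ hττ hρ hτ h
  have inj := sum_injOn' hρρ hττ hρ hτ h
  -- the exact vertex `111`: boxes `B011 = S₀+T₁+U₁`, `B101 = S₁+T₀+U₁`, `B110 = S₁+T₁+U₀`
  set B011 := (S₀ ×ˢ T₁ ×ˢ U₁).image fun p : A × A × A => p.1 + p.2.1 + p.2.2 with hB011
  set B101 := (S₁ ×ˢ T₀ ×ˢ U₁).image fun p : A × A × A => p.1 + p.2.1 + p.2.2 with hB101
  set B110 := (S₁ ×ˢ T₁ ×ˢ U₀).image fun p : A × A × A => p.1 + p.2.1 + p.2.2 with hB110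
  have d₁ : Disjoint B101 B011 := (disjoint_sumset₁' hρρ hρτ hτρ hττ hne h) true mS₁ mT₀ mU₁ mS₀ mT₁
  have d₂ : Disjoint B110 B101 := (disjoint_sumset₂' hρρ hρτ hτρ hττ hne h) true mS₁ mT₁ mU₀ mS₁ mT₀ mU₁
  have d₃ : Disjoint B011 B110 := (disjoint_sumset₃' hρρ hρτ hτρ hττ hne h) true mS₀ mT₁ mU₁ mS₁ mU₀
  have sh₁ : Disjoint B101 (B011.image (· + c₀)) :=
    (disjoint_sumset₁_shift' hρρ hρτ hττ hne h) true mS₁ mT₀ mU₁ mS₀ mT₁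
  have sh₂ : Disjoint (B101.image (· + c₀)) B110 :=
    (disjoint_sumset₂_shift' hρρ hρτ hττ hne h) true mS₁ mT₀ mU₁ mS₁ mT₁ mU₀
  have c011 : B011.card = 2 * T₁.card * U₁.card := by rw [hB011, cs false true true mS₀ mT₁ mU₁, hs₀]
  have c101 : B101.card = 2 * 2 * U₁.card := by rw [hB101, cs true false true mS₁ mT₀ mU₁, hs₁, ht₀]
  have c110 : B110.card = 2 * T₁.card * U₀.card := by rw [hB110, cs true true false mS₁ mT₁ mU₀, hs₁]
  have hper101 : B101.image (· + c₀) = B101 :=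
    periodic_of_exact_vertex d₁ d₂.symm d₃ (by rw [c011, c101, c110, ← hex]; ring)
      (disjoint_image_add_comm h2c sh₁) sh₂
  -- `S₁ = {s, s + d}`, `T₀ = {t, t + e}`
  have hS₁eq : S₁ = {s, s + (s' - s)} := by
    rw [add_sub_cancel]
    exact (eq_of_subset_of_card_le (by
      intro x hx; rcases mem_insert.1 hx with rfl | hx
      · exact hs
      · rw [mem_singleton.1 hx]; exact hs') (by rw [hs₁, card_pair hss])).symm
  have hT₀eq : T₀ = {t, t + (t' - t)} := by
    rw [add_sub_cancel]
    exact (eq_of_subset_of_card_le (by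
      intro x hx; rcases mem_insert.1 hx with rfl | hx
      · exact ht
      · rw [mem_singleton.1 hx]; exact ht') (by rw [ht₀, card_pair htt])).symm
  have hinj : Set.InjOn (fun p : A × A × A => p.1 + p.2.1 + p.2.2)
      ↑(({s, s + (s' - s)} : Finset A) ×ˢ ({t, t + (t' - t)} : Finset A) ×ˢ U₁) := by
    rw [← hS₁eq, ← hT₀eq]; exact inj true false true mS₁ mT₀ mU₁
  have hper : ((({s, s + (s' - s)} : Finset A) ×ˢ ({t, t + (t' - t)} : Finset A) ×ˢ U₁).image
      fun p : A × A × A => p.1 + p.2.1 + p.2.2).image (· + c₀) =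
      (({s, s + (s' - s)} : Finset A) ×ˢ ({t, t + (t' - t)} : Finset A) ×ˢ U₁).image
      fun p : A × A × A => p.1 + p.2.1 + p.2.2 := by
    rw [← hS₁eq, ← hT₀eq]; exact hper101
  exact pair_diff_trichotomy_of_periodic_box π hker hc₀ hB (sub_ne_zero.2 hss.symm) (sub_ne_zero.2 htt.symm) hodd
    hinj hper

/-- **N3 triples have a stable member** (normalised: `|U₁|` odd, vertex `111` exact).  Dicyclic type, `π : A →+ B` with
kernel `{0,c₀}`, `B` a `2`-group; TPP triple with `|S₀| = |S₁| = |T₀| = |T₁| = 2`, `|U₁|` odd and `8|U₁| + 4|U₀| = |A|`.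
Then there is a central involution `ρ(a)` (`2a = 0 ≠ a`) with `Sρ(a) = S` or `Tρ(a) = T`. [folklore] -/
theorem n3_stable_member_aux
    (hρρ : ∀ a b, ρ a * ρ b = ρ (a + b)) (hρτ : ∀ a b, ρ a * τ b = τ (b - a))
    (hτρ : ∀ a b, τ a * ρ b = τ (a + b)) (hττ : ∀ a b, τ a * τ b = ρ (c₀ + b - a)) (hc₀ : c₀ ≠ 0)
    (hρ : Function.Injective ρ) (hτ : Function.Injective τ) (hne : ∀ a b, ρ a ≠ τ b)
    (hsurj : ∀ g, (∃ a, ρ a = g) ∨ (∃ a, τ a = g))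
    (π : A →+ B) (hker : ∀ a : A, π a = 0 ↔ a = 0 ∨ a = c₀) {m : ℕ} (hB : ∀ b : B, (2 ^ m) • b = 0)
    {S T U : Finset G} (h : TripleProductProperty S T U)
    (hs₀ : (univ.filter fun a : A => ρ a ∈ S).card = 2) (hs₁ : (univ.filter fun a : A => τ a ∈ S).card = 2)
    (ht₀ : (univ.filter fun a : A => ρ a ∈ T).card = 2) (ht₁ : (univ.filter fun a : A => τ a ∈ T).card = 2)
    (hodd : Odd (univ.filter fun a : A => τ a ∈ U).card)
    (hex : 8 * (univ.filter fun a : A => τ a ∈ U).card + 4 * (univ.filter fun a : A => ρ a ∈ U).card = Fintype.card A) :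
    ∃ a : A, a + a = 0 ∧ a ≠ 0 ∧ ((∀ x ∈ S, x * ρ a ∈ S) ∨ (∀ x ∈ T, x * ρ a ∈ T)) := by
  set S₀ : Finset A := univ.filter fun a => ρ a ∈ S with hS₀
  set S₁ : Finset A := univ.filter fun a => τ a ∈ S with hS₁
  set T₀ : Finset A := univ.filter fun a => ρ a ∈ T with hT₀
  set T₁ : Finset A := univ.filter fun a => τ a ∈ T with hT₁
  set U₀ : Finset A := univ.filter fun a => ρ a ∈ U with hU₀
  set U₁ : Finset A := univ.filter fun a => τ a ∈ U with hU₁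
  have er : (Equiv.mulRight (1 : G)).toEmbedding = Function.Embedding.refl G := by ext x; simp
  -- the two elements of each two-element part
  obtain ⟨s₀, s₀', hss₀, hS₀eq⟩ := card_eq_two.1 hs₀
  obtain ⟨s₁, s₁', hss₁, hS₁eq⟩ := card_eq_two.1 hs₁
  obtain ⟨t₀, t₀', htt₀, hT₀eq⟩ := card_eq_two.1 ht₀
  obtain ⟨t₁, t₁', htt₁, hT₁eq⟩ := card_eq_two.1 ht₁
  have ms₀ : s₀ ∈ S₀ := by rw [hS₀eq]; exact mem_insert_self _ _
  have ms₀' : s₀' ∈ S₀ := by rw [hS₀eq]; exact mem_insert_of_mem (mem_singleton_self _)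
  have ms₁ : s₁ ∈ S₁ := by rw [hS₁eq]; exact mem_insert_self _ _
  have ms₁' : s₁' ∈ S₁ := by rw [hS₁eq]; exact mem_insert_of_mem (mem_singleton_self _)
  have mt₀ : t₀ ∈ T₀ := by rw [hT₀eq]; exact mem_insert_self _ _
  have mt₀' : t₀' ∈ T₀ := by rw [hT₀eq]; exact mem_insert_of_mem (mem_singleton_self _)
  have mt₁ : t₁ ∈ T₁ := by rw [hT₁eq]; exact mem_insert_self _ _
  have mt₁' : t₁' ∈ T₁ := by rw [hT₁eq]; exact mem_insert_of_mem (mem_singleton_self _)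
  -- the translates `S·τ0`, `T·τ0` and their parts
  set S' := S.map (Equiv.mulRight (τ 0)).toEmbedding with hS'
  set T' := T.map (Equiv.mulRight (τ 0)).toEmbedding with hT'
  have hS'₀ : (univ.filter fun a : A => ρ a ∈ S') = S₁.image fun b => -c₀ - b := rho_part_mulRight_tau hρρ hρτ hττ S
  have hS'₁ : (univ.filter fun a : A => τ a ∈ S') = S₀.image fun b => -b := tau_part_mulRight_tau hρρ hττ S
  have hT'₀ : (univ.filter fun a : A => ρ a ∈ T') = T₁.image fun b => -c₀ - b := rho_part_mulRight_tau hρρ hρτ hττ T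
  have hT'₁ : (univ.filter fun a : A => τ a ∈ T') = T₀.image fun b => -b := tau_part_mulRight_tau hρρ hττ T
  have cS'₀ : (univ.filter fun a : A => ρ a ∈ S').card = 2 := by
    rw [hS'₀, card_image_of_injective _ sub_right_injective, hs₁]
  have cS'₁ : (univ.filter fun a : A => τ a ∈ S').card = 2 := by
    rw [hS'₁, card_image_of_injective _ neg_injective, hs₀]
  have cT'₀ : (univ.filter fun a : A => ρ a ∈ T').card = 2 := by
    rw [hT'₀, card_image_of_injective _ sub_right_injective, ht₁]
  have cT'₁ : (univ.filter fun a : A => τ a ∈ T').card = 2 := by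
    rw [hT'₁, card_image_of_injective _ neg_injective, ht₀]
  -- TPP of the translates
  have hS'T : TripleProductProperty S' T U := by
    have := h.map_mulRight (τ 0) 1 1; simpa only [er, Finset.map_refl] using this
  have hST' : TripleProductProperty S T' U := by
    have := h.map_mulRight 1 (τ 0) 1; simpa only [er, Finset.map_refl] using this
  have hS'T' : TripleProductProperty S' T' U := by
    have := h.map_mulRight (τ 0) (τ 0) 1; simpa only [er, Finset.map_refl] using this
  have mS'₁ : ∀ {b}, b ∈ S₀ → -b ∈ (univ.filter fun a : A => τ a ∈ S') := fun hb => by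
    rw [hS'₁]; exact mem_image_of_mem _ hb
  have mT'₀ : ∀ {b}, b ∈ T₁ → -c₀ - b ∈ (univ.filter fun a : A => ρ a ∈ T') := fun hb => by
    rw [hT'₀]; exact mem_image_of_mem _ hb
  -- the exactness hypothesis in the form used by the core
  have hexT : 2 * (univ.filter fun a : A => τ a ∈ T).card * U₁.card + 4 * U₁.card +
      2 * (univ.filter fun a : A => τ a ∈ T).card * U₀.card = Fintype.card A := by rw [ht₁]; omega
  have hexT' : 2 * (univ.filter fun a : A => τ a ∈ T').card * U₁.card + 4 * U₁.card +
      2 * (univ.filter fun a : A => τ a ∈ T').card * U₀.card = Fintype.card A := by rw [cT'₁]; omega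
  -- the four trichotomies
  have h10 := n3_pair_trichotomy_core hρρ hρτ hτρ hττ hc₀ hρ hτ hne π hker hB h hs₀ hs₁ ht₀ hodd hexT
    ms₁ ms₁' hss₁ mt₀ mt₀' htt₀
  have h00 := n3_pair_trichotomy_core hρρ hρτ hτρ hττ hc₀ hρ hτ hne π hker hB hS'T cS'₀ cS'₁ ht₀ hodd hexT
    (mS'₁ ms₀') (mS'₁ ms₀) (fun h' => hss₀ (neg_injective h').symm) mt₀ mt₀' htt₀
  have h11 := n3_pair_trichotomy_core hρρ hρτ hτρ hττ hc₀ hρ hτ hne π hker hB hST' hs₀ hs₁ cT'₀ hodd hexT'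
    ms₁ ms₁' hss₁ (mT'₀ mt₁') (mT'₀ mt₁) (fun h' => htt₁ (sub_right_injective h').symm)
  have h01 := n3_pair_trichotomy_core hρρ hρτ hτρ hττ hc₀ hρ hτ hne π hker hB hS'T' cS'₀ cS'₁ cT'₀ hodd hexT'
    (mS'₁ ms₀') (mS'₁ ms₀) (fun h' => hss₀ (neg_injective h').symm) (mT'₀ mt₁') (mT'₀ mt₁)
    (fun h' => htt₁ (sub_right_injective h').symm)
  -- normalise the differences
  have e_d₀ : -s₀ - -s₀' = s₀' - s₀ := by abel
  have e_e₁ : -c₀ - t₁ - (-c₀ - t₁') = t₁' - t₁ := by abel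
  rw [e_d₀] at h00 h01
  rw [e_e₁] at h11 h01
  -- injectivity conditions `dᵢ ≠ ±eⱼ` from the injective boxes `Sᵢ + Tⱼ + U₁`
  have mS₀c : ∀ a ∈ S₀, cond false (τ a) (ρ a) ∈ S := fun a ha => by simpa [hS₀] using ha
  have mS₁c : ∀ a ∈ S₁, cond true (τ a) (ρ a) ∈ S := fun a ha => by simpa [hS₁] using ha
  have mT₀c : ∀ a ∈ T₀, cond false (τ a) (ρ a) ∈ T := fun a ha => by simpa [hT₀] using ha
  have mT₁c : ∀ a ∈ T₁, cond true (τ a) (ρ a) ∈ T := fun a ha => by simpa [hT₁] using ha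
  have mU₁c : ∀ a ∈ U₁, cond true (τ a) (ρ a) ∈ U := fun a ha => by simpa [hU₁] using ha
  have inj := sum_injOn' hρρ hττ hρ hτ h
  obtain ⟨u, hu⟩ : U₁.Nonempty := card_pos.1 hodd.pos
  have ninj : ∀ {i j : Bool} {X Y : Finset A}, (∀ a ∈ X, cond i (τ a) (ρ a) ∈ S) → (∀ b ∈ Y, cond j (τ b) (ρ b) ∈ T) →
      ∀ {x x' y y' : A}, x ∈ X → x' ∈ X → y ∈ Y → y' ∈ Y → x ≠ x' → (x' - x ≠ y' - y ∧ x' - x ≠ -(y' - y)) := by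
    intro i j X Y hX hY x x' y y' hx hx' hy hy' hxx
    have hI := inj i j true hX hY mU₁c
    constructor
    · intro heq
      have key : x' + y + u = x + y' + u := by
        rw [sub_eq_sub_iff_add_eq_add] at heq; rw [heq, add_comm y' x]
      have := hI (show (x', y, u) ∈ (↑(X ×ˢ Y ×ˢ U₁) : Set (A × A × A)) by simp [hx', hy, hu])
        (show (x, y', u) ∈ (↑(X ×ˢ Y ×ˢ U₁) : Set (A × A × A)) by simp [hx, hy', hu]) key
      exact hxx (congrArg Prod.fst this).symm
    · intro heq
      have key : x' + y' + u = x + y + u := by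
        rw [neg_sub, sub_eq_sub_iff_add_eq_add] at heq; rw [add_comm x y, ← heq]
      have := hI (show (x', y', u) ∈ (↑(X ×ˢ Y ×ˢ U₁) : Set (A × A × A)) by simp [hx', hy', hu])
        (show (x, y, u) ∈ (↑(X ×ˢ Y ×ˢ U₁) : Set (A × A × A)) by simp [hx, hy, hu]) key
      exact hxx (congrArg Prod.fst this).symm
  have n00 := ninj mS₀c mT₀c ms₀ ms₀' mt₀ mt₀' hss₀
  have n01 := ninj mS₀c mT₁c ms₀ ms₀' mt₁ mt₁' hss₀
  have n10 := ninj mS₁c mT₀c ms₁ ms₁' mt₀ mt₀' hss₁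
  have n11 := ninj mS₁c mT₁c ms₁ ms₁' mt₁ mt₁' hss₁
  -- the stable pair
  rcases stable_pair_of_trichotomy π hker hc₀ (sub_ne_zero.2 hss₀.symm) (sub_ne_zero.2 hss₁.symm)
      (sub_ne_zero.2 htt₀.symm) (sub_ne_zero.2 htt₁.symm) h00 h01 h10 h11 n00 n01 n10 n11 with
    ⟨hd, h2d⟩ | ⟨he, h2e⟩
  · refine ⟨s₀' - s₀, h2d, sub_ne_zero.2 hss₀.symm, Or.inl fun x hx => ?_⟩
    rcases hsurj x with ⟨b, rfl⟩ | ⟨b, rfl⟩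
    · have hb : b ∈ S₀ := mem_filter.2 ⟨mem_univ _, hx⟩
      rw [hρρ]
      have : b + (s₀' - s₀) ∈ S₀ := by
        rw [hS₀eq, mem_insert, mem_singleton] at hb ⊢
        rcases hb with rfl | rfl
        · right; abel
        · left; rw [show b + (b - s₀) = s₀ + ((b - s₀) + (b - s₀)) by abel, h2d, add_zero]
      exact (mem_filter.1 this).2
    · have hb : b ∈ S₁ := mem_filter.2 ⟨mem_univ _, hx⟩
      rw [hτρ, hd]
      have : b + (s₁' - s₁) ∈ S₁ := by
        rw [hS₁eq, mem_insert, mem_singleton] at hb ⊢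
        rcases hb with rfl | rfl
        · right; abel
        · left; rw [show b + (b - s₁) = s₁ + ((b - s₁) + (b - s₁)) by abel, ← hd, h2d, add_zero]
      exact (mem_filter.1 this).2
  · refine ⟨t₀' - t₀, h2e, sub_ne_zero.2 htt₀.symm, Or.inr fun x hx => ?_⟩
    rcases hsurj x with ⟨b, rfl⟩ | ⟨b, rfl⟩
    · have hb : b ∈ T₀ := mem_filter.2 ⟨mem_univ _, hx⟩
      rw [hρρ]
      have : b + (t₀' - t₀) ∈ T₀ := by
        rw [hT₀eq, mem_insert, mem_singleton] at hb ⊢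
        rcases hb with rfl | rfl
        · right; abel
        · left; rw [show b + (b - t₀) = t₀ + ((b - t₀) + (b - t₀)) by abel, h2e, add_zero]
      exact (mem_filter.1 this).2
    · have hb : b ∈ T₁ := mem_filter.2 ⟨mem_univ _, hx⟩
      rw [hτρ, he]
      have : b + (t₁' - t₁) ∈ T₁ := by
        rw [hT₁eq, mem_insert, mem_singleton] at hb ⊢
        rcases hb with rfl | rfl
        · right; abel
        · left; rw [show b + (b - t₁) = t₁ + ((b - t₁) + (b - t₁)) by abel, ← he, h2e, add_zero]
      exact (mem_filter.1 this).2

/-- **No N3-class dicyclic-law triple when `A/⟨c₀⟩` is a `2`-group mapping onto `𝔽₂³`.**  Dicyclic type (`c₀ ≠ 0`),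
`|A| ≡ 2 (mod 3)`, `|A| ≥ 28`, three homomorphisms `A →+ ZMod 2` killing `c₀` jointly onto `𝔽₂³`, `π : A →+ B` onto with kernel
`{0, c₀}`, `2^m · B = 0`.  Then no TPP triple with `|S₀| = |S₁| = |T₀| = |T₁| = 2` attains `3|S||T||U| + 16 = 8|A|`.
(Vertex counting forces `{|U₀|, |U₁|} = {u, u+1}` with `u` even — the balanced case contradicts `8 ∣ |A|` — so after a
`τ0`-translation of `U` the normalised lemma `n3_stable_member_aux` applies, and `no_dicyclic_law_of_stable_member` concludes.)
[folklore] -/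
theorem no_n3_dicyclic_law
    (hρρ : ∀ a b, ρ a * ρ b = ρ (a + b)) (hρτ : ∀ a b, ρ a * τ b = τ (b - a))
    (hτρ : ∀ a b, τ a * ρ b = τ (a + b)) (hττ : ∀ a b, τ a * τ b = ρ (c₀ + b - a)) (hc₀ : c₀ ≠ 0)
    (hρ : Function.Injective ρ) (hτ : Function.Injective τ) (hne : ∀ a b, ρ a ≠ τ b)
    (hsurj : ∀ g, (∃ a, ρ a = g) ∨ (∃ a, τ a = g)) (hmod : Fintype.card A % 3 = 2) (hA : 28 ≤ Fintype.card A)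
    (ψ₁ ψ₂ ψ₃ : A →+ ZMod 2) (hψc : ψ₁ c₀ = 0 ∧ ψ₂ c₀ = 0 ∧ ψ₃ c₀ = 0)
    (hψ : ∀ v : ZMod 2 × ZMod 2 × ZMod 2, ∃ x, (ψ₁ x, ψ₂ x, ψ₃ x) = v)
    (π : A →+ B) (hker : ∀ a : A, π a = 0 ↔ a = 0 ∨ a = c₀) {m : ℕ} (hB : ∀ b : B, (2 ^ m) • b = 0)
    {S T U : Finset G} (h : TripleProductProperty S T U)
    (hs₀ : (univ.filter fun a : A => ρ a ∈ S).card = 2) (hs₁ : (univ.filter fun a : A => τ a ∈ S).card = 2)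
    (ht₀ : (univ.filter fun a : A => ρ a ∈ T).card = 2) (ht₁ : (univ.filter fun a : A => τ a ∈ T).card = 2) :
    3 * (S.card * T.card * U.card) + 16 ≠ 8 * Fintype.card A := by
  intro hV
  have cS : S.card = 4 := by rw [card_eq_parts' hρ hτ hne hsurj S, hs₀, hs₁]
  have cT : T.card = 4 := by rw [card_eq_parts' hρ hτ hne hsurj T, ht₀, ht₁]
  have cU := card_eq_parts' hρ hτ hne hsurj U
  have h8 : 8 ∣ Fintype.card A := eight_dvd_card_of_onto ψ₁ ψ₂ ψ₃ hψ
  obtain ⟨-, -, h000, h111⟩ := parts_counting' hρρ hρτ hτρ hττ hρ hτ hne h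
  rw [hs₀, hs₁, ht₀, ht₁] at h000 h111
  rw [cS, cT, cU] at hV
  set u₀ := (univ.filter fun a : A => ρ a ∈ U).card with hu₀
  set u₁ := (univ.filter fun a : A => τ a ∈ U).card with hu₁
  obtain ⟨k, hk⟩ := h8
  -- the stability conclusion, in both orientations of `U`
  have key : ∃ a : A, a + a = 0 ∧ a ≠ 0 ∧ ((∀ x ∈ S, x * ρ a ∈ S) ∨ (∀ x ∈ T, x * ρ a ∈ T)) := by
    by_cases hcase : u₁ = u₀ + 1
    · have hodd : Odd u₁ := ⟨u₀ / 2, by omega⟩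
      exact n3_stable_member_aux hρρ hρτ hτρ hττ hc₀ hρ hτ hne hsurj π hker hB h hs₀ hs₁ ht₀ ht₁ hodd (by omega)
    · have hcase' : u₀ = u₁ + 1 := by omega
      -- translate `U` by `τ0`: the parts swap
      have er : (Equiv.mulRight (1 : G)).toEmbedding = Function.Embedding.refl G := by ext x; simp
      have h' : TripleProductProperty S T (U.map (Equiv.mulRight (τ 0)).toEmbedding) := by
        have := h.map_mulRight 1 1 (τ 0); simpa only [er, Finset.map_refl] using this
      have cU'₀ := card_rho_part_mulRight_tau hρρ hρτ hττ (A := A) U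
      have cU'₁ := card_tau_part_mulRight_tau hρρ hττ (A := A) U
      have hodd : Odd (univ.filter fun a : A => τ a ∈ U.map (Equiv.mulRight (τ 0)).toEmbedding).card := by
        rw [cU'₁]; exact ⟨u₁ / 2, by omega⟩
      exact n3_stable_member_aux hρρ hρτ hτρ hττ hc₀ hρ hτ hne hsurj π hker hB h' hs₀ hs₁ ht₀ ht₁ hodd
        (by rw [cU'₀, cU'₁]; omega)
  obtain ⟨a, ha2, ha0, hstab⟩ := key
  have hstab' : (∀ x ∈ S, x * ρ a ∈ S) ∨ (∀ x ∈ T, x * ρ a ∈ T) ∨ (∀ x ∈ U, x * ρ a ∈ U) := by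
    rcases hstab with hs | ht
    · exact Or.inl hs
    · exact Or.inr (Or.inl ht)
  have hV' : 3 * (S.card * T.card * U.card) + 16 = 8 * Fintype.card A := by rw [cS, cT, cU]; exact hV
  exact no_dicyclic_law_of_stable_member hρρ hρτ hτρ hττ hc₀ hρ hτ hne hsurj hmod hA ψ₁ ψ₂ ψ₃ hψc hψ h ha2 ha0
    hstab' hV'

end N3

end Summit.MatrixMultiplication.OmegaCensus
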